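import Literature.AnabelianGeometry.AbsoluteAnabelian.AbsTopIProp23iGFGAffineModel
import Literature.AnabelianGeometry.AbsoluteAnabelian.AbsTopIProp23GFGSurfaceModelExtension
import Literature.AnabelianGeometry.AbsoluteAnabelian.AbsTopIDef21GFGQuotientExistence
import Literature.AnabelianGeometry.SemiGraphs.ProSigmaCompletionModels
import HarnessLib

/-!
# [AbsTopI] Prop 2.2 / 2.3 (i)(ii) for extensions `1 → Δ → Π → G → 1` whose `Δ` IS the GFG construction — AFFINE case

S. Mochizuki, *Topics in Absolute Anabelian Geometry I: Generalities* (2012) [AbsTopI] (lit key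
`paper:url-11ac98ba15fc`), Def 2.1 (i)(ii) p. 17, Prop 2.2 p. 18, Prop 2.3 (i)(ii) p. 19.  PROOF-ONLY packaging (no
definition, no named fact; abc-iut-w6-d071, the affine twin of abc-iut-w6-d030's
`AbsTopIProp23GFGSurfaceModelExtension.lean`, p440871): abc-iut-w6-d071's
`FundamentalExtension.prop22_prop23_of_isOpen_proSigma_hyperbolic_mlf` / `_nf` (p436367) prove the three node
predicates `E.GeomTFG`, `E.GeomSlimElastic`, `E.ArithSlimNotElastic` for an extension whose `Δ` has an open normal
`U′` presented as a pro-`Σ` completion of a hyperbolic `Γ_{g,r}`, MODULO (FN) "`Δ` has no nontrivial finite normal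
subgroup".  When `Δ = E.geom` IS the Def 2.1 (i) quotient `D` of a pro-`Σ′` completion `P` of a FREE group `Γ` of
rank `n ≥ 2` (the topological `π₁` of an affine hyperbolic curve; `U′ = π(U)`), (FN) is the THEOREM
`GFGAffineModel.forall_finite_normal_eq_bot` (p443001), so the three predicates hold outright:

* `exists_puncturedSurfaceGroup_completion_gfg_affine` — `π(U)` is a pro-`Σ` completion of `Γ_{0, n′+1}` (free of
  rank `n′ = [P : U](n − 1) + 1 ≥ 2`; Schreier);
* `geomSlimElastic_gfg_affine`, `prop22_prop23_gfg_affine_mlf`, `prop22_prop23_gfg_affine_nf` — the typed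
  predicates at the affine GFG construction, hypotheses = the Def 2.1 (i) data only; `…_puncturedSurfaceGroup_mlf`
  / `_nf` — the same for `Γ = Γ_{g,k+1}` hyperbolic;
* `GFGAffineModel.exists_slim_and_elastic_gfgQuotient` — NON-VACUITY at honest data (twin of w6-d030's p441593):
  for EVERY pro-`Σ′` completion `P` of a free group of rank `≥ 2` and EVERY open normal `U ⊴ P` the Def 2.1 (i)
  quotient `P ⧸ K_Σ(U)` EXISTS (`GFGSurfaceModel.exists_gfgQuotient`) and is slim, elastic, without nontrivial finite
  normal subgroups; `GFGAffineModel.exists_model` — a fully explicit inhabitant (`Γ = F₂`, `P` a pro-`Σ′` completion,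
  `U = P`).

HONEST SCOPE: model-level (Riemann-existence presentation; affine curves; the proper case is p440871); nothing here
bears on [IUTchIII] Cor. 3.12; no side is taken.
-/

noncomputable section

open Topology

namespace Literature.AnabelianGeometry.AbsoluteAnabelian

namespace FundamentalExtension

open Literature.AlgebraicGeometry.Frobenioids (IsSlimGroup)
open Literature.AnabelianGeometry.SemiGraphs.PSCDatum (IsMaxProSigmaQuotient)
open Literature.AnabelianGeometry.SemiGraphs.SemiGraphOfAnabelioids
open Literature.AnabelianGeometry.SemiGraphs.SemiGraphOfAnabelioids.IsProSigmaCompletion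
open Literature.GroupTheory.CombinatorialGroupTheory
open Literature.GroupTheory.ProfiniteSubquotients

variable {E : FundamentalExtension.{0}} {Sigma Sigma' : Set ℕ} {Γ : Type} [Group Γ] [IsFreeGroup Γ]
  [Finite (IsFreeGroup.Generators Γ)]
  {P : Type} [Group P] [TopologicalSpace P] [IsTopologicalGroup P] [CompactSpace P]
  [TotallyDisconnectedSpace P] {j : Γ →* P} {π : P →* E.geom} {U : Subgroup P}

/-- At the affine GFG construction, the open subgroup `π(U) ⊆ Δ = E.geom` is presented as a pro-`Σ` completion of a
punctured surface group `Γ_{0, n′+1}` — free of rank `n′ = |Generators j⁻¹U| ≥ 2` (Schreier) — along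
`Γ_{0,n′+1} ≅ F(Fin 0 × Bool ⊕ Fin n′) ≅ F(Generators j⁻¹U) ≅ j⁻¹U`. [cite: MochizukiAbsTopI2012, Def 2.1 (i) p.17] -/
theorem exists_puncturedSurfaceGroup_completion_gfg_affine (hn : 2 ≤ Nat.card (IsFreeGroup.Generators Γ))
    (hSS : Sigma ⊆ Sigma') (hj : IsProSigmaCompletion Sigma' j) (hUo : IsOpen (U : Set P))
    (hπc : Continuous π) (hmax : IsMaxProSigmaQuotient Sigma (π.subgroupMap U)) :
    ∃ (n' : ℕ) (ι : PuncturedSurfaceGroup 0 (n' + 1) →* (U.map π : Subgroup E.geom)),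
      2 ≤ n' ∧ IsProSigmaCompletion Sigma ι := by
  classical
  haveI : CompactSpace E.geom := isCompact_iff_compactSpace.mp E.isClosed_geom.isCompact
  haveI : (U.comap j).FiniteIndex := finiteIndex_comap hj U hUo
  obtain ⟨hfin, hn₂⟩ := GFGAffineModel.two_le_card_generators_of_finiteIndex hn (U.comap j)
  haveI := hfin
  letI : Fintype (IsFreeGroup.Generators (U.comap j)) := Fintype.ofFinite _
  have hιU := GFGSurfaceModel.isProSigmaCompletion_map hSS hj hUo hπc hmax
  set n' : ℕ := Fintype.card (IsFreeGroup.Generators (U.comap j)) with hn'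
  have hn'2 : 2 ≤ n' := by rwa [hn', ← Nat.card_eq_fintype_card]
  obtain ⟨e0⟩ := PuncturedSurfaceGroup.nonempty_mulEquiv_freeGroup 0 n'
  -- `F(Fin 0 × Bool ⊕ Fin n′) ≅ F(Generators j⁻¹U) ≅ j⁻¹U`
  let eg : (Fin 0 × Bool ⊕ Fin n') ≃ IsFreeGroup.Generators (U.comap j) :=
    (Equiv.emptySum _ _).trans (Fintype.equivFin _).symm
  let e' : PuncturedSurfaceGroup 0 (n' + 1) ≃* (U.comap j : Subgroup Γ) :=
    e0.trans ((FreeGroup.freeGroupCongr eg).trans (IsFreeGroup.toFreeGroup (U.comap j)).symm)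
  refine ⟨n', ((π.subgroupMap U).comp (j.subgroupComap U)).comp e'.toMonoidHom, hn'2, ?_⟩
  exact hιU.of_comp_mulEquiv e' (fun _ => rfl)

/-- **[AbsTopI] Prop 2.3 (i) `E.GeomSlimElastic` at the affine GFG construction** (any base `G`): `Δ = E.geom` the
Def 2.1 (i) quotient (affine case) is slim and elastic — `GFGAffineModel.slim_and_elastic` (p443001).
[cite: MochizukiAbsTopI2012, Prop 2.3 (i) p.19] -/
theorem geomSlimElastic_gfg_affine (hn : 2 ≤ Nat.card (IsFreeGroup.Generators Γ)) (hSS : Sigma ⊆ Sigma')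
    (hS : ∃ ℓ ∈ Sigma, ℓ.Prime) (hj : IsProSigmaCompletion Sigma' j) [U.Normal] (hUo : IsOpen (U : Set P))
    (hπc : Continuous π) (hπs : Function.Surjective π) (hker : π.ker ≤ U)
    (hmax : IsMaxProSigmaQuotient Sigma (π.subgroupMap U)) : E.GeomSlimElastic := by
  haveI : CompactSpace E.geom := isCompact_iff_compactSpace.mp E.isClosed_geom.isCompact
  exact GFGAffineModel.slim_and_elastic hn hSS hS hj hUo hπc hπs hker hmax

/-- **[AbsTopI] Prop 2.2 + Prop 2.3 (i) + Prop 2.3 (ii) at the affine GFG construction, MLF base**: for an extension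
`1 → Δ → Π → G → 1` with MLF base data whose `Δ` is the Def 2.1 (i) quotient (affine case: `Γ` free of rank `≥ 2`),
`Δ` is t.f.g., slim and elastic, and `Π` is slim but not elastic — p436367 with (FN) :=
`GFGAffineModel.forall_finite_normal_eq_bot`. [cite: MochizukiAbsTopI2012, Prop 2.3 p.19] -/
theorem prop22_prop23_gfg_affine_mlf (B : E.MLFBase) (hn : 2 ≤ Nat.card (IsFreeGroup.Generators Γ))
    (hSS : Sigma ⊆ Sigma') (hS : ∃ ℓ ∈ Sigma, ℓ.Prime) (hSp : ∀ p ∈ Sigma, p.Prime)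
    (hj : IsProSigmaCompletion Sigma' j) [U.Normal] (hUo : IsOpen (U : Set P)) (hπc : Continuous π)
    (hπs : Function.Surjective π) (hker : π.ker ≤ U) (hmax : IsMaxProSigmaQuotient Sigma (π.subgroupMap U)) :
    E.GeomTFG ∧ E.GeomSlimElastic ∧ E.ArithSlimNotElastic := by
  haveI : CompactSpace E.geom := isCompact_iff_compactSpace.mp E.isClosed_geom.isCompact
  obtain ⟨n', ι, hn'2, hι⟩ := exists_puncturedSurfaceGroup_completion_gfg_affine hn hSS hj hUo hπc hmax
  have hgr : PuncturedSurfaceGroup.IsHyperbolicType 0 (n' + 1) := by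
    unfold PuncturedSurfaceGroup.IsHyperbolicType; omega
  have hfin := GFGAffineModel.forall_finite_normal_eq_bot hn hSS hS hj hUo hπc hπs hker hmax
  obtain ⟨ℓ, hℓS, _⟩ := hS
  exact prop22_prop23_of_isOpen_proSigma_hyperbolic_mlf B ⟨ℓ, hℓS⟩ hSp hgr (U.map π)
    (GFGSurfaceModel.isOpen_map hUo hπc hπs hker) ι hι hfin

/-- **The same, NF base.** [cite: MochizukiAbsTopI2012, Prop 2.3 p.19] -/
theorem prop22_prop23_gfg_affine_nf (B : E.NFBase) (hn : 2 ≤ Nat.card (IsFreeGroup.Generators Γ))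
    (hSS : Sigma ⊆ Sigma') (hS : ∃ ℓ ∈ Sigma, ℓ.Prime) (hSp : ∀ p ∈ Sigma, p.Prime)
    (hj : IsProSigmaCompletion Sigma' j) [U.Normal] (hUo : IsOpen (U : Set P)) (hπc : Continuous π)
    (hπs : Function.Surjective π) (hker : π.ker ≤ U) (hmax : IsMaxProSigmaQuotient Sigma (π.subgroupMap U)) :
    E.GeomTFG ∧ E.GeomSlimElastic ∧ E.ArithSlimNotElastic := by
  haveI : CompactSpace E.geom := isCompact_iff_compactSpace.mp E.isClosed_geom.isCompact
  obtain ⟨n', ι, hn'2, hι⟩ := exists_puncturedSurfaceGroup_completion_gfg_affine hn hSS hj hUo hπc hmax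
  have hgr : PuncturedSurfaceGroup.IsHyperbolicType 0 (n' + 1) := by
    unfold PuncturedSurfaceGroup.IsHyperbolicType; omega
  have hfin := GFGAffineModel.forall_finite_normal_eq_bot hn hSS hS hj hUo hπc hπs hker hmax
  obtain ⟨ℓ, hℓS, _⟩ := hS
  exact prop22_prop23_of_isOpen_proSigma_hyperbolic_nf B ⟨ℓ, hℓS⟩ hSp hgr (U.map π)
    (GFGSurfaceModel.isOpen_map hUo hπc hπs hker) ι hι hfin

end FundamentalExtension

/-! ### The punctured surface groups `Γ_{g,k+1}` -/

namespace FundamentalExtension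

open Literature.AnabelianGeometry.SemiGraphs.PSCDatum (IsMaxProSigmaQuotient)
open Literature.AnabelianGeometry.SemiGraphs.SemiGraphOfAnabelioids
open Literature.GroupTheory.CombinatorialGroupTheory

variable {E : FundamentalExtension.{0}} {Sigma Sigma' : Set ℕ} {g k : ℕ}
  {P : Type} [Group P] [TopologicalSpace P] [IsTopologicalGroup P] [CompactSpace P]
  [TotallyDisconnectedSpace P] {j : PuncturedSurfaceGroup g (k + 1) →* P} {π : P →* E.geom} {U : Subgroup P}

/-- **[AbsTopI] Prop 2.3 (i) `E.GeomSlimElastic` at the GFG construction over `Γ_{g,k+1}`** (hyperbolic affine type).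
[cite: MochizukiAbsTopI2012, Prop 2.3 (i) p.19] -/
theorem geomSlimElastic_gfg_puncturedSurfaceGroup (hgk : PuncturedSurfaceGroup.IsHyperbolicType g (k + 1))
    (hSS : Sigma ⊆ Sigma') (hS : ∃ ℓ ∈ Sigma, ℓ.Prime) (hj : IsProSigmaCompletion Sigma' j) [U.Normal]
    (hUo : IsOpen (U : Set P)) (hπc : Continuous π) (hπs : Function.Surjective π) (hker : π.ker ≤ U)
    (hmax : IsMaxProSigmaQuotient Sigma (π.subgroupMap U)) : E.GeomSlimElastic := by
  obtain ⟨hF, hfin, hn⟩ := GFGAffineModel.exists_isFreeGroup_puncturedSurfaceGroup hgk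
  haveI := hF; haveI := hfin
  exact geomSlimElastic_gfg_affine hn hSS hS hj hUo hπc hπs hker hmax

/-- **[AbsTopI] Prop 2.2 + 2.3 (i)(ii) at the GFG construction over `Γ_{g,k+1}`, MLF base.**
[cite: MochizukiAbsTopI2012, Prop 2.3 p.19] -/
theorem prop22_prop23_gfg_puncturedSurfaceGroup_mlf (B : E.MLFBase)
    (hgk : PuncturedSurfaceGroup.IsHyperbolicType g (k + 1)) (hSS : Sigma ⊆ Sigma') (hS : ∃ ℓ ∈ Sigma, ℓ.Prime)
    (hSp : ∀ p ∈ Sigma, p.Prime) (hj : IsProSigmaCompletion Sigma' j) [U.Normal] (hUo : IsOpen (U : Set P))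
    (hπc : Continuous π) (hπs : Function.Surjective π) (hker : π.ker ≤ U)
    (hmax : IsMaxProSigmaQuotient Sigma (π.subgroupMap U)) :
    E.GeomTFG ∧ E.GeomSlimElastic ∧ E.ArithSlimNotElastic := by
  obtain ⟨hF, hfin, hn⟩ := GFGAffineModel.exists_isFreeGroup_puncturedSurfaceGroup hgk
  haveI := hF; haveI := hfin
  exact prop22_prop23_gfg_affine_mlf B hn hSS hS hSp hj hUo hπc hπs hker hmax

/-- **The same, NF base.** [cite: MochizukiAbsTopI2012, Prop 2.3 p.19] -/
theorem prop22_prop23_gfg_puncturedSurfaceGroup_nf (B : E.NFBase)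
    (hgk : PuncturedSurfaceGroup.IsHyperbolicType g (k + 1)) (hSS : Sigma ⊆ Sigma') (hS : ∃ ℓ ∈ Sigma, ℓ.Prime)
    (hSp : ∀ p ∈ Sigma, p.Prime) (hj : IsProSigmaCompletion Sigma' j) [U.Normal] (hUo : IsOpen (U : Set P))
    (hπc : Continuous π) (hπs : Function.Surjective π) (hker : π.ker ≤ U)
    (hmax : IsMaxProSigmaQuotient Sigma (π.subgroupMap U)) :
    E.GeomTFG ∧ E.GeomSlimElastic ∧ E.ArithSlimNotElastic := by
  obtain ⟨hF, hfin, hn⟩ := GFGAffineModel.exists_isFreeGroup_puncturedSurfaceGroup hgk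
  haveI := hF; haveI := hfin
  exact prop22_prop23_gfg_affine_nf B hn hSS hS hSp hj hUo hπc hπs hker hmax

end FundamentalExtension

/-! ### Non-vacuity: the affine GFG construction exists and the theorems apply to it -/

namespace GFGAffineModel

open Literature.AlgebraicGeometry.Frobenioids (IsSlimGroup)
open Literature.AnabelianGeometry.SemiGraphs.PSCDatum (IsMaxProSigmaQuotient)
open Literature.AnabelianGeometry.SemiGraphs.SemiGraphOfAnabelioids
open Literature.GroupTheory.ProfiniteSubquotients

universe u

variable {Sigma Sigma' : Set ℕ} {P : Type u} [Group P] [TopologicalSpace P] [IsTopologicalGroup P]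
  [CompactSpace P] [TotallyDisconnectedSpace P]

/-- **Non-vacuity at honest data (affine case)**: for `P` ANY pro-`Σ′` completion of a free group `Γ` of rank `≥ 2`
and `U ⊴ P` ANY open normal subgroup (`Σ ⊆ Σ′`, `Σ` containing a prime), the Def 2.1 (i) quotient
`Δ_X := P ⧸ K_Σ(U)` EXISTS (w6-d030's `GFGSurfaceModel.exists_gfgQuotient`, p441593) and IS slim, elastic and
without nontrivial finite normal subgroups (p443001 at this datum). [cite: MochizukiAbsTopI2012, Def 2.1 (i) p.17] -/
theorem exists_slim_and_elastic_gfgQuotient (hSS : Sigma ⊆ Sigma') (hS : ∃ ℓ ∈ Sigma, ℓ.Prime)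
    {Γ : Type*} [Group Γ] [IsFreeGroup Γ] [Finite (IsFreeGroup.Generators Γ)]
    (hn : 2 ≤ Nat.card (IsFreeGroup.Generators Γ)) {j : Γ →* P} (hj : IsProSigmaCompletion Sigma' j)
    (U : Subgroup P) [U.Normal] (hUo : IsOpen (U : Set P)) :
    ∃ (K : Subgroup P) (_ : K.Normal) (_ : IsClosed (K : Set P)), K ≤ U ∧
      IsMaxProSigmaQuotient Sigma ((QuotientGroup.mk' K).subgroupMap U) ∧
      IsSlimGroup (P ⧸ K) ∧ IsElastic (P ⧸ K) ∧
      ∀ N : Subgroup (P ⧸ K), N.Normal → (N : Set (P ⧸ K)).Finite → N = ⊥ := by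
  obtain ⟨K, hKn, hKc, hKU, hmax⟩ := GFGSurfaceModel.exists_gfgQuotient Sigma U hUo
  haveI := hKn
  haveI : IsClosed ((K : Subgroup P) : Set P) := hKc
  haveI : TotallyDisconnectedSpace (P ⧸ K) := totallyDisconnectedSpace_quotient K hKc
  have hker : (QuotientGroup.mk' K).ker ≤ U := by rw [QuotientGroup.ker_mk']; exact hKU
  obtain ⟨hs, he⟩ := slim_and_elastic hn hSS hS hj hUo QuotientGroup.continuous_mk
    (QuotientGroup.mk'_surjective K) hker hmax
  exact ⟨K, hKn, hKc, hKU, hmax, hs, he, forall_finite_normal_eq_bot hn hSS hS hj hUo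
    QuotientGroup.continuous_mk (QuotientGroup.mk'_surjective K) hker hmax⟩

/-- **A fully explicit inhabitant of the affine GFG hypotheses**: `Γ = F₂` (free on `Fin 2`), `P` a pro-`Σ′`
completion of `Γ` (`IsProSigmaCompletion.exists_isProSigmaCompletion`), `U = P`; the Def 2.1 (i) quotient exists and
the conclusions (T3)(T4) hold for it — so p443001's theorems are not vacuous. [cite: MochizukiAbsTopI2012, Def 2.1 (i) p.17] -/
theorem exists_model (Sigma Sigma' : Set ℕ) (hSS : Sigma ⊆ Sigma') (hS : ∃ ℓ ∈ Sigma, ℓ.Prime) :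
    ∃ (Q : ProfiniteGrp.{0}) (j : FreeGroup (Fin 2) →* Q) (U : Subgroup Q) (_ : U.Normal) (K : Subgroup Q)
      (_ : K.Normal), IsProSigmaCompletion Sigma' j ∧ IsOpen (U : Set Q) ∧ IsClosed (K : Set Q) ∧ K ≤ U ∧
      IsMaxProSigmaQuotient Sigma ((QuotientGroup.mk' K).subgroupMap U) ∧
      IsSlimGroup (Q ⧸ K) ∧ IsElastic (Q ⧸ K) ∧
      ∀ N : Subgroup (Q ⧸ K), N.Normal → (N : Set (Q ⧸ K)).Finite → N = ⊥ := by
  classical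
  obtain ⟨Q, j, hj⟩ := IsProSigmaCompletion.exists_isProSigmaCompletion (FreeGroup (Fin 2)) Sigma'
  haveI : Finite (IsFreeGroup.Generators (FreeGroup (Fin 2))) :=
    Finite.of_equiv _ (Equiv.ofFreeGroupEquiv (IsFreeGroup.toFreeGroup (FreeGroup (Fin 2))))
  have hn : 2 ≤ Nat.card (IsFreeGroup.Generators (FreeGroup (Fin 2))) := by
    rw [← Nat.card_congr (Equiv.ofFreeGroupEquiv (IsFreeGroup.toFreeGroup (FreeGroup (Fin 2)))), Nat.card_fin]
  obtain ⟨K, hKn, hKc, hKU, hmax, hs, he, hfn⟩ :=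
    exists_slim_and_elastic_gfgQuotient hSS hS hn hj (⊤ : Subgroup Q) isOpen_univ
  exact ⟨Q, j, ⊤, inferInstance, K, hKn, hj, isOpen_univ, hKc, hKU, hmax, hs, he, hfn⟩

end GFGAffineModel

end Literature.AnabelianGeometry.AbsoluteAnabelian

end
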